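import Summits.QuantumFields.YangMills.Theorems.UnitScaleTiltProp7NestedMeanParallelLiftInhabited
import HarnessLib

/-!
# Route `UnitScaleTilt`, crux K1 child «MinimiserStabilityRegPr» (stmt-QuantumFields-19200), skeleton v10, stub `stub_existenceMinimalOrbit` (EX), route (α), line «SYM-CENTRE»
# (★★OWNER RULING g28-№7 cure (ii-a); LOCATE #56∕#57, row (R1-diag), first half) — **`hLift` AT A BACKGROUND WHOSE BOND VARIABLES COMMUTE WITH EVERY PARALLEL COARSE CONSTANT**:
# if every `Ū₀`-parallel coarse section is a CONSTANT `c₀` commuting with all fine bond variables `U₀♭(b)`, then the constant fine section lifts it — the abstract form of the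
# DIAGONAL case of the trichotomy (`U₀♭` diagonal, `Par_V ∩ 𝔰𝔲(2) = ℝσ₃`: the symmetric abelian lift of (R4)) and of ✓`hLift_of_onlyScalarParallel` (scalars commute with everything).

Cell `ym3-torus`, width seat `ym3-torus-px20` (gen 2).  THEOREMS ONLY (0 `def`, 0 `sorry`).  `--supports stmt-QuantumFields-19200 --as helper`, count-neutral.  YM₃ on T³ is a ladder
rung (R3), not the Clay problem; nothing here claims the stub, the crux, d = 4 or the mass gap.

WHAT IS PROVED (sorry-free, no definition; ns `…Theorems.Prop7NestedMeanParallelLift`): ★`hLift_of_parallelConstCommuting` (T³ member; the `hLift` text of ✓`hHZ_of_parallelLift` VERBATIM as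
conclusion).  HONEST SCOPE: bookkeeping; the diagonalising coarse gauge (from a non-scalar parallel section) and the abelian lift itself are the line's rows (R1-diag, second half; R3; R4),
not here; no stub ∕ crux statement is advanced; NOT a closure of the sector (RULING g28-№5∕№6).

References: T. Bałaban, CMP 99 (1985) 389–434 [Balaban1985BackgroundPropagators] ((3.21) p.394); CMP 96 (1984) 223–250 [Balaban1984PropagatorsII] ((2.12) p.225).
-/

set_option autoImplicit false

noncomputable section

open scoped BigOperators Matrix.Norms.L2Operator

namespace Summit.QuantumFields.YangMills.Theorems.Prop7NestedMeanParallelLift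

open Literature.MathematicalPhysics.QuantumFieldTheory.Balaban1983to89
open T4Continuum BlockAveraging
open B15DeterminingSets (embIter)
open Summit.QuantumFields.YangMills.Theorems.Prop8Chart (emlIterU)

section T3

open Literature.MathematicalPhysics.QuantumFieldTheory.Balaban1983to89.T3ContinuumYM3Torus
open T3SectALandauChart (bgUnits)

variable (F : T3Family) {n K : ℕ}

/-- ★ **`hLift` WHEN EVERY PARALLEL COARSE SECTION IS A CONSTANT COMMUTING WITH THE FINE BOND VARIABLES** (the diagonal∕abelian case of the SYM-CENTRE trichotomy in abstract
form): the constant fine section is `U₀♭`-parallel (`U c₀ U⁻¹ = c₀`) and restricts to the given coarse section. [cite: Balaban1985BackgroundPropagators, (3.21) p.394; Balaban1984PropagatorsII, (2.12) p.225] -/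
theorem hLift_of_parallelConstCommuting (U₀ : GaugeField (F.P K) 0 (Matrix.specialUnitaryGroup (Fin 2) ℂ))
    (hPar : ∀ cf : Site (F.P K) (K - n) → Matrix (Fin 2) (Fin 2) ℂ,
      (∀ e : PBond (F.P K) (K - n), cf e.src = ((emlIterU (K - n) (bgUnits F K U₀) e : (Matrix (Fin 2) (Fin 2) ℂ)ˣ) : Matrix (Fin 2) (Fin 2) ℂ) * cf e.tgt *
        (((emlIterU (K - n) (bgUnits F K U₀) e)⁻¹ : (Matrix (Fin 2) (Fin 2) ℂ)ˣ) : Matrix (Fin 2) (Fin 2) ℂ)) →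
      ∃ c₀ : Matrix (Fin 2) (Fin 2) ℂ, (∀ y, cf y = c₀) ∧ ∀ b : PBond (F.P K) 0, Commute c₀ ((bgUnits F K U₀ b : (Matrix (Fin 2) (Fin 2) ℂ)ˣ) : Matrix (Fin 2) (Fin 2) ℂ)) :
    ∀ cf : Site (F.P K) (K - n) → Matrix (Fin 2) (Fin 2) ℂ,
      (∀ e : PBond (F.P K) (K - n), cf e.src = ((emlIterU (K - n) (bgUnits F K U₀) e : (Matrix (Fin 2) (Fin 2) ℂ)ˣ) : Matrix (Fin 2) (Fin 2) ℂ) * cf e.tgt *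
        (((emlIterU (K - n) (bgUnits F K U₀) e)⁻¹ : (Matrix (Fin 2) (Fin 2) ℂ)ˣ) : Matrix (Fin 2) (Fin 2) ℂ)) →
      ∃ l₀ : Site (F.P K) 0 → Matrix (Fin 2) (Fin 2) ℂ,
        (∀ b : PBond (F.P K) 0, l₀ b.src = ((bgUnits F K U₀ b : (Matrix (Fin 2) (Fin 2) ℂ)ˣ) : Matrix (Fin 2) (Fin 2) ℂ) * l₀ b.tgt * (((bgUnits F K U₀ b)⁻¹ : (Matrix (Fin 2) (Fin 2) ℂ)ˣ) : Matrix (Fin 2) (Fin 2) ℂ)) ∧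
        ∀ y : Site (F.P K) (K - n), l₀ (embIter (K - n) y) = cf y := by
  intro cf hcf
  obtain ⟨c₀, hc₀, hcomm⟩ := hPar cf hcf
  refine ⟨fun _ => c₀, fun b => ?_, fun y => (hc₀ y).symm⟩
  rw [← (hcomm b).eq, mul_assoc, Units.mul_inv, mul_one]

end T3

end Summit.QuantumFields.YangMills.Theorems.Prop7NestedMeanParallelLift

end
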